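import Literature.LinearAlgebra.Matrix.QInversiveSemisimple
import HarnessLib

/-!
# Goresky–Tai 2017, Prop. 38 (proof): direct sums of `q`-inversive elements `γ = ⊕ⱼ γⱼ` («a product of symplectic
# matrices γⱼ»), semisimplicity of direct sums, and the exceptional semisimple blocks `√q·I` and `(0 1; q 0)` for
# the factors `(x − √q)²`, `(x² − q)²`

Topic `Literature/LinearAlgebra/Matrix`; THEOREMS ONLY (no definition, no instance, no named fact; D-0026 net
debt 0).  Lane `lit-hodgefound` (summit `HodgeConjecture`, Track 2 foundations library), seat
`lit-hodgefound-p15`, generation 56, row g56-#14; complements `QInversiveSemisimpleRepresentative` (g56-#13: the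
generic case of «moreover γ may be chosen semisimple») with the glue and the exceptional blocks of the printed proof.

THE PRINT.  M. Goresky, Y.-S. Tai, *Real structures on ordinary Abelian varieties*, arXiv:1701.07742
[GoreskyTai2017RealStructuresOrdinary], App. §16.2, proof of Proposition 38 (p0037–p0038), verbatim:

> `r(x) = ∏(x − √q)² ∏(x + √q)² = ∏(x² − q)² ∏(x² ± 2√q x + q)²` … The first factor corresponds to a product of
> symplectic matrices `(0 q; 1 0)` while the second factor corresponds to the symplectic matrix `±(√q I 0; 0 √q I)`,
> both of which have multiplier `q`. … Take `A = Diag(A₁^{×m₁}, ⋯, A_r^{×m_r})` … Then `B, C` will also be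
> block-diagonal matrices, and `γ` will be the corresponding product of symplectic matrices `γⱼ`. It suffices to
> show that each nonzero `γⱼ` is semisimple. … If `±√q` is a root of `hⱼ(x)` then `p(x) = (x − √q)²` or
> `p(x) = (x² − q)²` depending on whether or not `√q ∈ ℚ`. In the first case we may take `Aⱼ = √q`; `Bⱼ = Cⱼ = 0`
> and in the second case we may take `Aⱼ = (0 1; q 0)`; `Bⱼ = Cⱼ = 0`.

WHAT IS HERE (`K` a field; «semisimple» = `Module.End.IsSemisimple (Matrix.toLin' M)`):
* §1 **`isSemisimple_fromBlocks_zero_zero_iff`**: `diag(A, D)` is semisimple iff `A` and `D` are (⟸ through the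
  square-free `rad(m_A m_D)`), `isSemisimple_toLin'_reindex_iff` (re-indexing invariance).
* §2 direct sums of `q`-inversive data («γ will be the corresponding product of symplectic matrices γⱼ»):
  `relations_directSum` (the block-diagonal `A = A₁ ⊕ A₂, B = B₁ ⊕ B₂, C = C₁ ⊕ C₂` satisfy the relations),
  `fromBlocks_directSum_eq_reindex` (`γ = γ₁ ⊕ γ₂` up to the shuffle `(m₁ ⊕ m₂) ⊕ (m₁ ⊕ m₂) ≃ (m₁ ⊕ m₁) ⊕ (m₂ ⊕ m₂)`),
  `charpoly_directSum` (`p_γ = p_{γ₁} p_{γ₂}`), **`isSemisimple_directSum_iff`**.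
* §3 the exceptional blocks: **`scalar_block`** (`A = sI`, `B = C = 0`, `s² = q`: relations, semisimple, `p_γ = (x − s)^{2·#m}`),
  **`swap_block`** (`A = (0 1; q 0)`, `B = C = 0`: relations; semisimple when `2 ≠ 0`, `q ≠ 0`; `p_γ = (x² − q)²`), and
  `transform_X_sq_sub_four_mul` (`(x² − q)² = 𝒯_q(x² − 4q)`: the block realises the real-counterpart factor `x² − 4q`
  of the lineage's normalisation `p_γ = 𝒯_q(p_{2A})`).

## References
* [GoreskyTai2017RealStructuresOrdinary] M. Goresky, Y.-S. Tai, Real structures on ordinary Abelian varieties,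
  arXiv:1701.07742 (2017), App. §16.2, proof of Proposition 38 (p0037–p0038).
-/

open Matrix Polynomial

namespace Literature.LinearAlgebra.Matrix.QInversiveDirectSum

variable {K : Type*} [Field K]

/-! ## §1 Semisimplicity of block-diagonal matrices and re-indexing -/

/-- **`diag(A, D)` is semisimple iff `A` and `D` are** (⟸: the square-free radical of `m_A·m_D` kills both blocks).
[cite: GoreskyTai2017RealStructuresOrdinary, App. §16.2 proof of Prop. 38 «It suffices to show that each nonzero γⱼ is semisimple» (p0038)] -/
theorem isSemisimple_fromBlocks_zero_zero_iff {m n : Type*} [Fintype m] [DecidableEq m] [Fintype n] [DecidableEq n]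
    (A : Matrix m m K) (D : Matrix n n K) :
    Module.End.IsSemisimple (Matrix.toLin' (fromBlocks A 0 0 D)) ↔
      Module.End.IsSemisimple (Matrix.toLin' A) ∧ Module.End.IsSemisimple (Matrix.toLin' D) := by
  classical
  refine ⟨QInversiveSemisimple.isSemisimple_of_fromBlocks_zero_zero, fun ⟨hA, hD⟩ => ?_⟩
  obtain ⟨s, hs, hs0⟩ := (QInversiveSemisimple.isSemisimple_toLin'_iff A).mp hA
  obtain ⟨t, ht, ht0⟩ := (QInversiveSemisimple.isSemisimple_toLin'_iff D).mp hD
  have hst : s * t ≠ 0 := mul_ne_zero hs.ne_zero ht.ne_zero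
  obtain ⟨s', hs'⟩ := (UniqueFactorizationMonoid.dvd_radical_iff hs.isRadical hst).mpr (dvd_mul_right s t)
  obtain ⟨t', ht'⟩ := (UniqueFactorizationMonoid.dvd_radical_iff ht.isRadical hst).mpr (dvd_mul_left t s)
  refine QInversiveSemisimple.isSemisimple_fromBlocks_zero_zero_of_aeval_eq_zero
    (UniqueFactorizationMonoid.squarefree_radical (a := s * t)) ?_ ?_
  · rw [hs', map_mul, hs0, zero_mul]
  · rw [ht', map_mul, ht0, zero_mul]

/-- Semisimplicity is invariant under re-indexing. [cite: GoreskyTai2017RealStructuresOrdinary, App. §16.2 proof of Prop. 38 (p0038)] -/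
theorem isSemisimple_toLin'_reindex_iff {m n : Type*} [Fintype m] [DecidableEq m] [Fintype n] [DecidableEq n]
    (e : m ≃ n) (M : Matrix m m K) :
    Module.End.IsSemisimple (Matrix.toLin' (Matrix.reindex e e M)) ↔ Module.End.IsSemisimple (Matrix.toLin' M) := by
  rw [QInversiveSemisimple.isSemisimple_toLin'_iff, QInversiveSemisimple.isSemisimple_toLin'_iff]
  refine exists_congr fun s => and_congr_right fun _ => ?_
  have h := aeval_algHom_apply (Matrix.reindexAlgEquiv K K e) M s
  rw [Matrix.coe_reindexAlgEquiv] at h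
  rw [h]
  exact (Matrix.reindexAlgEquiv K K e).map_eq_zero_iff

/-! ## §2 Direct sums of `q`-inversive data -/

section DirectSum

variable {R : Type*} [CommRing R] {m₁ m₂ : Type*} [Fintype m₁] [DecidableEq m₁] [Fintype m₂] [DecidableEq m₂]

/-- The block-diagonal data `A₁ ⊕ A₂, B₁ ⊕ B₂, C₁ ⊕ C₂` satisfy the `q`-inversive relations when both summands do.
[cite: GoreskyTai2017RealStructuresOrdinary, App. §16.2 proof of Prop. 38 «Then B, C will also be block-diagonal matrices, and γ will be the corresponding product of symplectic matrices γⱼ» (p0038)] -/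
theorem relations_directSum {A₁ B₁ C₁ : Matrix m₁ m₁ R} {A₂ B₂ C₂ : Matrix m₂ m₂ R} {q : R} (hB₁ : B₁ᵀ = B₁)
    (hC₁ : C₁ᵀ = C₁) (hAB₁ : A₁ * B₁ = B₁ * A₁ᵀ) (hCA₁ : C₁ * A₁ = A₁ᵀ * C₁)
    (hq₁ : A₁ * A₁ - B₁ * C₁ = q • (1 : Matrix m₁ m₁ R)) (hB₂ : B₂ᵀ = B₂) (hC₂ : C₂ᵀ = C₂)
    (hAB₂ : A₂ * B₂ = B₂ * A₂ᵀ) (hCA₂ : C₂ * A₂ = A₂ᵀ * C₂) (hq₂ : A₂ * A₂ - B₂ * C₂ = q • (1 : Matrix m₂ m₂ R)) :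
    (fromBlocks B₁ 0 0 B₂)ᵀ = fromBlocks B₁ 0 0 B₂ ∧ (fromBlocks C₁ 0 0 C₂)ᵀ = fromBlocks C₁ 0 0 C₂ ∧
      fromBlocks A₁ 0 0 A₂ * fromBlocks B₁ 0 0 B₂ = fromBlocks B₁ 0 0 B₂ * (fromBlocks A₁ 0 0 A₂)ᵀ ∧
      fromBlocks C₁ 0 0 C₂ * fromBlocks A₁ 0 0 A₂ = (fromBlocks A₁ 0 0 A₂)ᵀ * fromBlocks C₁ 0 0 C₂ ∧
      fromBlocks A₁ 0 0 A₂ * fromBlocks A₁ 0 0 A₂ - fromBlocks B₁ 0 0 B₂ * fromBlocks C₁ 0 0 C₂ =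
        q • (1 : Matrix (m₁ ⊕ m₂) (m₁ ⊕ m₂) R) := by
  refine ⟨?_, ?_, ?_, ?_, ?_⟩
  · rw [fromBlocks_transpose, hB₁, hB₂, transpose_zero, transpose_zero]
  · rw [fromBlocks_transpose, hC₁, hC₂, transpose_zero, transpose_zero]
  · rw [fromBlocks_transpose, fromBlocks_multiply, fromBlocks_multiply]
    simp [hAB₁, hAB₂]
  · rw [fromBlocks_transpose, fromBlocks_multiply, fromBlocks_multiply]
    simp [hCA₁, hCA₂]
  · rw [fromBlocks_multiply, fromBlocks_multiply]
    simp only [Matrix.mul_zero, Matrix.zero_mul, add_zero, zero_add]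
    rw [sub_eq_add_neg, fromBlocks_neg, fromBlocks_add]
    simp only [neg_zero, add_zero, ← sub_eq_add_neg, hq₁, hq₂]
    rw [← fromBlocks_one, fromBlocks_smul, smul_zero, smul_zero]

omit [Fintype m₁] [DecidableEq m₁] [Fintype m₂] [DecidableEq m₂] in
/-- `γ` of the direct-sum data is the re-indexed block sum `γ₁ ⊕ γ₂`.
[cite: GoreskyTai2017RealStructuresOrdinary, App. §16.2 proof of Prop. 38 «γ will be the corresponding product of symplectic matrices γⱼ» (p0038)] -/
theorem fromBlocks_directSum_eq_reindex (A₁ B₁ C₁ D₁ : Matrix m₁ m₁ R) (A₂ B₂ C₂ D₂ : Matrix m₂ m₂ R) :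
    fromBlocks (fromBlocks A₁ 0 0 A₂) (fromBlocks B₁ 0 0 B₂) (fromBlocks C₁ 0 0 C₂) (fromBlocks D₁ 0 0 D₂) =
      Matrix.reindex (Equiv.sumSumSumComm m₁ m₁ m₂ m₂) (Equiv.sumSumSumComm m₁ m₁ m₂ m₂)
        (fromBlocks (fromBlocks A₁ B₁ C₁ D₁) 0 0 (fromBlocks A₂ B₂ C₂ D₂)) := by
  ext i j
  rcases i with (i | i) | (i | i) <;> rcases j with (j | j) | (j | j) <;>
    simp [Matrix.reindex_apply, Equiv.sumSumSumComm, Equiv.sumAssoc, Equiv.sumComm, fromBlocks]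

/-- The characteristic polynomial of a direct sum is the product. [cite: GoreskyTai2017RealStructuresOrdinary, App. §16.2 proof of Prop. 38 «a factorization p(x) = ∏ pⱼ^{mⱼ}(x) into q-palindromic factors» (p0038)] -/
theorem charpoly_directSum (A₁ B₁ C₁ D₁ : Matrix m₁ m₁ R) (A₂ B₂ C₂ D₂ : Matrix m₂ m₂ R) :
    (fromBlocks (fromBlocks A₁ 0 0 A₂) (fromBlocks B₁ 0 0 B₂) (fromBlocks C₁ 0 0 C₂) (fromBlocks D₁ 0 0 D₂)).charpoly =
      (fromBlocks A₁ B₁ C₁ D₁).charpoly * (fromBlocks A₂ B₂ C₂ D₂).charpoly := by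
  rw [fromBlocks_directSum_eq_reindex, Matrix.charpoly_reindex, Matrix.charpoly_fromBlocks_zero₁₂]

end DirectSum

/-- **A direct sum is semisimple iff both summands are.** [cite: GoreskyTai2017RealStructuresOrdinary, App. §16.2 proof of Prop. 38 «It suffices to show that each nonzero γⱼ is semisimple» (p0038)] -/
theorem isSemisimple_directSum_iff {m₁ m₂ : Type*} [Fintype m₁] [DecidableEq m₁] [Fintype m₂] [DecidableEq m₂]
    (A₁ B₁ C₁ D₁ : Matrix m₁ m₁ K) (A₂ B₂ C₂ D₂ : Matrix m₂ m₂ K) :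
    Module.End.IsSemisimple (Matrix.toLin'
        (fromBlocks (fromBlocks A₁ 0 0 A₂) (fromBlocks B₁ 0 0 B₂) (fromBlocks C₁ 0 0 C₂) (fromBlocks D₁ 0 0 D₂))) ↔
      Module.End.IsSemisimple (Matrix.toLin' (fromBlocks A₁ B₁ C₁ D₁)) ∧
        Module.End.IsSemisimple (Matrix.toLin' (fromBlocks A₂ B₂ C₂ D₂)) := by
  rw [fromBlocks_directSum_eq_reindex, isSemisimple_toLin'_reindex_iff, isSemisimple_fromBlocks_zero_zero_iff]

/-! ## §3 The exceptional blocks -/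

/-- **The scalar block** `A = sI`, `B = C = 0` with `s² = q` («we may take Aⱼ = √q; Bⱼ = Cⱼ = 0»): `q`-inversive
relations, semisimple, characteristic polynomial `(x − s)^{#m} (x − s)^{#m}`.
[cite: GoreskyTai2017RealStructuresOrdinary, App. §16.2 proof of Prop. 38 «the symplectic matrix ±(√q I 0; 0 √q I)» and «we may take Aⱼ = √q; Bⱼ = Cⱼ = 0» (p0037–p0038)] -/
theorem scalar_block {m : Type*} [Fintype m] [DecidableEq m] {s q : K} (hs : s * s = q) :
    ((0 : Matrix m m K))ᵀ = 0 ∧ (s • (1 : Matrix m m K)) * 0 = 0 * (s • (1 : Matrix m m K))ᵀ ∧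
      (0 : Matrix m m K) * (s • (1 : Matrix m m K)) = (s • (1 : Matrix m m K))ᵀ * 0 ∧
      s • (1 : Matrix m m K) * (s • (1 : Matrix m m K)) - 0 * 0 = q • (1 : Matrix m m K) ∧
      Module.End.IsSemisimple (Matrix.toLin' (fromBlocks (s • (1 : Matrix m m K)) 0 0 (s • (1 : Matrix m m K))ᵀ)) ∧
      (fromBlocks (s • (1 : Matrix m m K)) 0 0 (s • (1 : Matrix m m K))ᵀ).charpoly =
        (X - C s) ^ Fintype.card m * (X - C s) ^ Fintype.card m := by
  have hA : Module.End.IsSemisimple (Matrix.toLin' (s • (1 : Matrix m m K))) :=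
    (QInversiveSemisimple.isSemisimple_toLin'_iff _).mpr ⟨X - C s, (irreducible_X_sub_C s).squarefree,
      by rw [map_sub, aeval_X, aeval_C, Algebra.algebraMap_eq_smul_one, sub_self]⟩
  have hchar : (s • (1 : Matrix m m K)).charpoly = (X - C s) ^ Fintype.card m := by
    rw [smul_one_eq_diagonal, charpoly_diagonal, Finset.prod_const, Finset.card_univ]
  refine ⟨transpose_zero, by rw [Matrix.mul_zero, Matrix.zero_mul], by rw [Matrix.zero_mul, Matrix.mul_zero], ?_,
    QInversiveSemisimple.isSemisimple_fromBlocks_self_transpose hA, ?_⟩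
  · rw [Matrix.mul_zero, sub_zero, Matrix.smul_mul, Matrix.one_mul, smul_smul, hs]
  · rw [charpoly_fromBlocks_zero₁₂, charpoly_transpose, hchar]

/-- **The swap block** `A = (0 1; q 0)` (`A² = qI`), `B = C = 0` («in the second case we may take Aⱼ = (0 1; q 0);
Bⱼ = Cⱼ = 0»): `q`-inversive relations and characteristic polynomial `(x² − q)²`; semisimple when `2 ≠ 0`, `q ≠ 0`.
[cite: GoreskyTai2017RealStructuresOrdinary, App. §16.2 proof of Prop. 38 (p0038)] -/
theorem swap_block (q : K) :
    (!![0, 1; q, 0] : Matrix (Fin 2) (Fin 2) K) * !![0, 1; q, 0] = q • (1 : Matrix (Fin 2) (Fin 2) K) ∧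
      (!![0, 1; q, 0] : Matrix (Fin 2) (Fin 2) K) * 0 = 0 * (!![0, 1; q, 0] : Matrix (Fin 2) (Fin 2) K)ᵀ ∧
      (0 : Matrix (Fin 2) (Fin 2) K) * !![0, 1; q, 0] = (!![0, 1; q, 0] : Matrix (Fin 2) (Fin 2) K)ᵀ * 0 ∧
      (!![0, 1; q, 0] : Matrix (Fin 2) (Fin 2) K) * !![0, 1; q, 0] - 0 * 0 = q • (1 : Matrix (Fin 2) (Fin 2) K) ∧
      (fromBlocks (!![0, 1; q, 0] : Matrix (Fin 2) (Fin 2) K) 0 0 (!![0, 1; q, 0])ᵀ).charpoly =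
        (X ^ 2 - C q) * (X ^ 2 - C q) := by
  have hsq : (!![0, 1; q, 0] : Matrix (Fin 2) (Fin 2) K) * !![0, 1; q, 0] = q • (1 : Matrix (Fin 2) (Fin 2) K) := by
    ext i j
    fin_cases i <;> fin_cases j <;> simp [Matrix.mul_apply, Fin.sum_univ_two]
  have htr : (!![0, 1; q, 0] : Matrix (Fin 2) (Fin 2) K).trace = 0 := by simp [Matrix.trace_fin_two]
  have hdet : (!![0, 1; q, 0] : Matrix (Fin 2) (Fin 2) K).det = -q := by simp [Matrix.det_fin_two]
  have hchar : (!![0, 1; q, 0] : Matrix (Fin 2) (Fin 2) K).charpoly = X ^ 2 - C q := by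
    rw [charpoly_fin_two, htr, hdet, map_zero, zero_mul, sub_zero, map_neg, ← sub_eq_add_neg]
  refine ⟨hsq, by rw [Matrix.mul_zero, Matrix.zero_mul], by rw [Matrix.zero_mul, Matrix.mul_zero],
    by rw [Matrix.mul_zero, sub_zero, hsq], ?_⟩
  rw [charpoly_fromBlocks_zero₁₂, charpoly_transpose, hchar]

/-- … and the swap block is semisimple when `2 ≠ 0` and `q ≠ 0` (`x² − q` is then separable).
[cite: GoreskyTai2017RealStructuresOrdinary, App. §16.2 proof of Prop. 38 «hence γⱼ is semisimple» (p0038)] -/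
theorem isSemisimple_swap_block (h2 : (2 : K) ≠ 0) {q : K} (hq0 : q ≠ 0) :
    Module.End.IsSemisimple
      (Matrix.toLin' (fromBlocks (!![0, 1; q, 0] : Matrix (Fin 2) (Fin 2) K) 0 0 (!![0, 1; q, 0])ᵀ)) := by
  refine QInversiveSemisimple.isSemisimple_fromBlocks_self_transpose
    ((QInversiveSemisimple.isSemisimple_toLin'_iff _).mpr ⟨X ^ 2 - C q, ?_, ?_⟩)
  · exact (separable_X_pow_sub_C q (by exact_mod_cast h2) hq0).squarefree
  · rw [map_sub, map_pow, aeval_X, aeval_C, Algebra.algebraMap_eq_smul_one, sq, (swap_block q).1, sub_self]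

/-- `(x² − q)² = 𝒯_q(x² − 4q)`: the swap block realises the real-counterpart factor `h = x² − 4q` (the root `±2√q`
excluded in `QInversiveSemisimpleRepresentative`). [cite: GoreskyTai2017RealStructuresOrdinary, App. §16.2 proof of Prop. 38 «∏(x² − q)²» (p0037)] -/
theorem transform_X_sq_sub_four_mul (q : K) :
    (∑ j ∈ Finset.range (2 + 1), C ((X ^ 2 - C (4 * q) : K[X]).coeff j) * X ^ (2 - j) * (X ^ 2 + C q) ^ j) =
      (X ^ 2 - C q) * (X ^ 2 - C q) := by
  simp only [Finset.sum_range_succ, Finset.sum_range_zero, coeff_sub, coeff_X_pow, coeff_C]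
  norm_num
  rw [show (C (4 : K) : K[X]) = 4 from map_ofNat C 4]
  ring

/-- `(x − s)² = 𝒯_q(x − 2s)` for `s² = q`: the scalar block of size one realises the real-counterpart factor `x − 2s`.
[cite: GoreskyTai2017RealStructuresOrdinary, App. §16.2 proof of Prop. 38 «∏(x² ± 2√q x + q)²» (p0037)] -/
theorem transform_X_sub_two_mul {s q : K} (hs : s * s = q) :
    (∑ j ∈ Finset.range (1 + 1), C ((X - C (2 * s) : K[X]).coeff j) * X ^ (1 - j) * (X ^ 2 + C q) ^ j) =
      (X - C s) * (X - C s) := by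
  rw [Literature.Algebra.Polynomial.QPalindromicRealCounterpart.transform_X_sub_C, ← hs, map_mul, map_mul,
    show (C (2 : K) : K[X]) = 2 from map_ofNat C 2]
  ring

end Literature.LinearAlgebra.Matrix.QInversiveDirectSum
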